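import Literature.NumberTheory.Transcendental.AnalytificationMorphismsProofs
import Literature.AlgebraicGeometry.Motives.JacobianAlbanese
import Literature.AlgebraicGeometry.Motives.AlgPointsSeparate
import Literature.AlgebraicGeometry.Motives.AbelianVarietyProjectiveChart
import Literature.Geometry.Kaehler.ComplexTorusLieGroup
import HarnessLib

/-!
# Holomorphic maps of uniformised abelian varieties are homomorphisms (GAGA for maps + rigidity)

Topic `Literature/AlgebraicGeometry/Motives` (family `hodge`), namespace
`Literature.AlgebraicGeometry.Motives`. Theorems only; no definition, no named fact, no `sorry`.
Companion of `ComplexTorusAlgebraicGroupLaw.lean` (a projective complex torus IS an abelian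
variety); this file is the functoriality half of "the category of abelian varieties over `ℂ` is
equivalent to the category of polarisable tori" (Mumford, *Abelian Varieties* (1970), §1 (3);
Lange–Birkenhake, *Complex Abelian Varieties* (1992), Ch. 1 §1.2 Prop. 1.2.1 with Ch. 2 §1,
Cor. 2.1.17: "every holomorphic map of abelian varieties is a morphism"; Mumford, *Algebraic
Geometry I* (1981), §4B (4.14)).

Let `A`, `A'` be abelian varieties over `ℂ` (`Motives.AbelianVariety ℂ`) with analytifications
`φ : M → A(ℂ)`, `φ' : M' → A'(ℂ)` by complex manifolds (`IsAnalytification`; e.g. complex tori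
`M = V/Λ`), and let `f : M → M'` be HOLOMORPHIC with `φ' (f x₀) = 1` for a point `x₀` over the
origin (`φ x₀ = 1`). Then:

* `AbelianVariety.exists_hom_of_mdifferentiable_of_isAnalytification` — there is a homomorphism of
  abelian varieties `u : A ⟶ A'` inducing `f` on complex points, `φ' (f x) = u(ℂ)(φ x)`: by GAGA for
  maps (`arapura2012_cor_15_4_6_holds`, Arapura 2012 Cor. 15.4.6 = Mumford 1981 (4.14)) `f` is
  induced by a morphism of varieties `g : A.X ⟶ A'.X`, which preserves the origin, hence is a
  homomorphism by rigidity (`AbelianVariety.homOfOneComp`, Milne 1986 Cor. 2.2);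
* `AbelianVariety.hom_eq_of_forall_complexPoints` — such a `u` is UNIQUE: homomorphisms of complex
  abelian varieties agreeing on `ℂ`-points are equal (`SchemeOver.hom_ext_of_forall_algPoints`,
  Mumford §4); with the consequences `…_comp`, `…_id`, `…_add` (the assignment `f ↦ u` is
  compatible with composition, identities and — for group-compatible `φ'` — with pointwise
  addition, `AlgPoints.map_hom_add`), which is what makes `End(V/Λ) → End(A)` a ring
  homomorphism for a CM torus (Shimura 1998 §6.2; consumer: the realisation of CM abelian
  varieties, `PicardCM.CMAbelianVarietyRealised`);
* torus forms `…_complexTorus` with `x₀ = 0`, `f 0 = 0`.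

All manifold types are in `Type` (universe `0`), as in the record `Arapura2012_Cor_15_4_6`.

## References

* D. Mumford, *Algebraic Geometry I: Complex Projective Varieties* (1981), §4B (4.14) p. 67.
  [Mumford1981]
* H. Lange, Ch. Birkenhake, *Complex Abelian Varieties* (1992), Ch. 1 Prop. 1.2.1, Ch. 2 Cor. 2.1.17.
  [LangeBirkenhake1992]
* D. Mumford, *Abelian Varieties* (1970), §1 (3), §4, §19. [MumfordAV1970]
* J. S. Milne, *Abelian Varieties* (1986), Cor. 2.2. [Milne1986AbelianVarieties]
-/

noncomputable section

open scoped Manifold ContDiff Topology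
open CategoryTheory AlgebraicGeometry MonoidalCategory CartesianMonoidalCategory
open Literature.NumberTheory.Transcendental Literature.Geometry.Kaehler

namespace Literature.AlgebraicGeometry.Motives

namespace AbelianVariety

/-! ### Homomorphisms are determined by complex points; pointwise addition -/

section Points

variable {A B C : AbelianVariety ℂ}

/-- **Homomorphisms of complex abelian varieties agreeing on `ℂ`-points are equal** (Mumford,
*Abelian Varieties*, §4: `ℂ`-points are dense in the reduced finite-type `A`, and `B` is
separated; the tree's `SchemeOver.hom_ext_of_forall_algPoints` with `Ω = ℂ`).
[cite: MumfordAV1970, §4] -/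
theorem hom_eq_of_forall_complexPoints {u v : A ⟶ B}
    (h : ∀ P : A.Points ℂ, AlgPoints.map u.hom.hom.hom P = AlgPoints.map v.hom.hom.hom P) :
    u = v := by
  haveI : IsReduced A.X.left := isReduced_left A
  exact hom_ext u v (SchemeOver.hom_ext_of_forall_algPoints ℂ fun P ↦ h P)

/-- **Addition of homomorphisms is pointwise on points**: `(u + v)(P) = u(P) · v(P)` in the
(multiplicatively written) group `B(L)` (Mumford, *Abelian Varieties*, §19, first paragraph;
Mathlib `MonObj.comp_mul`). [cite: MumfordAV1970, §19 (first paragraph)] -/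
theorem map_hom_add {k : Type} [Field k] {A B : AbelianVariety k} {L : Type} [Field L]
    [Algebra k L] (u v : A ⟶ B) (P : A.Points L) :
    AlgPoints.map (u + v).hom.hom.hom P =
      AlgPoints.map u.hom.hom.hom P * AlgPoints.map v.hom.hom.hom P := by
  rw [AlgPoints.map_apply, hom_add, Grp.Hom.hom_mul, Mon.Hom.hom_mul, MonObj.comp_mul]
  rfl

/-- The identity homomorphism acts as the identity on points. [cite: MumfordAV1970, §4] -/
theorem map_hom_id {k : Type} [Field k] {A : AbelianVariety k} {L : Type} [Field L] [Algebra k L]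
    (P : A.Points L) : AlgPoints.map (𝟙 A : A ⟶ A).hom.hom.hom P = P :=
  Category.comp_id _

/-- A composite of homomorphisms acts as the composite on points. [cite: MumfordAV1970, §4] -/
theorem map_hom_comp {k : Type} [Field k] {A B C : AbelianVariety k} {L : Type} [Field L]
    [Algebra k L] (u : A ⟶ B) (v : B ⟶ C) (P : A.Points L) :
    AlgPoints.map (u ≫ v).hom.hom.hom P = AlgPoints.map v.hom.hom.hom (AlgPoints.map u.hom.hom.hom P) :=
  (Category.assoc _ _ _).symm

end Points

/-! ### GAGA for maps + rigidity: holomorphic maps are homomorphisms -/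

section Analytic

variable {E : Type} [NormedAddCommGroup E] [NormedSpace ℂ E] [FiniteDimensional ℂ E]
  {M : Type} [TopologicalSpace M] [ChartedSpace E M] [IsManifold 𝓘(ℂ, E) ω M]
  {E' : Type} [NormedAddCommGroup E'] [NormedSpace ℂ E'] [FiniteDimensional ℂ E']
  {M' : Type} [TopologicalSpace M'] [ChartedSpace E' M'] [IsManifold 𝓘(ℂ, E') ω M']
  {A A' : AbelianVariety ℂ} {φ : M → ComplexPoints A.X} {φ' : M' → ComplexPoints A'.X}

open scoped MonObj in
/-- **A holomorphic map of complex abelian varieties preserving the origin is a homomorphism**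
(Mumford 1981 §4B (4.14) "every holomorphic map `f : X → Y` is a regular correspondence" +
rigidity, Milne 1986 Cor. 2.2; Lange–Birkenhake 1992 Prop. 1.2.1 / Cor. 2.1.17; Mumford AV §1 (3)).
For analytifications `φ : M → A(ℂ)`, `φ' : M' → A'(ℂ)` (complex manifolds with holomorphic
atlases) and `f : M → M'` holomorphic with `φ x₀ = 1`, `φ' (f x₀) = 1`, there is `u : A ⟶ A'` with
`φ' (f x) = u(ℂ)(φ x)` for all `x`. [cite: Mumford1981, §4B Corollary (4.14), p. 67]
[cite: Milne1986AbelianVarieties, §2 Cor. 2.2] -/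
theorem exists_hom_of_mdifferentiable_of_isAnalytification
    (hφ : IsAnalytification E A.X A.dim φ) (hφ' : IsAnalytification E' A'.X A'.dim φ')
    {f : M → M'} (hf : MDifferentiable 𝓘(ℂ, E) 𝓘(ℂ, E') f) {x₀ : M} (hx₀ : φ x₀ = 1)
    (hfx₀ : φ' (f x₀) = 1) :
    ∃ u : A ⟶ A', ∀ x : M, φ' (f x) = AlgPoints.map u.hom.hom.hom (φ x) := by
  obtain ⟨g, hg⟩ := arapura2012_cor_15_4_6_holds A.X A'.X isSmoothProjective_holds
    isSmoothProjective_holds E M φ hφ E' M' φ' hφ' f hf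
  -- `g` preserves the origin: checked after composing with `Spec ℂ → 𝟙_`
  have h1 : η[A.X] ≫ g = η[A'.X] := by
    have hS : toSpecOver (𝟙_ (SchemeOver ℂ)) ≫ toUnit (specOver ℂ ℂ) = 𝟙 _ := toUnit_unique _ _
    have key : toUnit (specOver ℂ ℂ) ≫ η[A.X] ≫ g = toUnit (specOver ℂ ℂ) ≫ η[A'.X] := by
      have h0 : toUnit (specOver ℂ ℂ) ≫ η[A.X] = φ x₀ := by rw [← Hom.one_def]; exact hx₀.symm
      have h0' : toUnit (specOver ℂ ℂ) ≫ η[A'.X] = φ' (f x₀) := by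
        rw [← Hom.one_def]; exact hfx₀.symm
      rw [← Category.assoc, h0, h0', hg x₀]
      rfl
    calc η[A.X] ≫ g = (toSpecOver (𝟙_ (SchemeOver ℂ)) ≫ toUnit (specOver ℂ ℂ)) ≫ η[A.X] ≫ g := by
          rw [hS, Category.id_comp]
      _ = (toSpecOver (𝟙_ (SchemeOver ℂ)) ≫ toUnit (specOver ℂ ℂ)) ≫ η[A'.X] := by
          rw [Category.assoc, Category.assoc, key]
      _ = η[A'.X] := by rw [hS, Category.id_comp]
  exact ⟨homOfOneComp g h1, fun x ↦ hg x⟩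

end Analytic

/-! ### Uniqueness and compatibilities of the induced homomorphism -/

section Unique

variable {E : Type} [NormedAddCommGroup E] [NormedSpace ℂ E] [FiniteDimensional ℂ E]
  {M : Type} [TopologicalSpace M] [ChartedSpace E M] {M' M'' : Type}
  {A A' A'' : AbelianVariety ℂ}
  {φ : M → ComplexPoints A.X} {φ' : M' → ComplexPoints A'.X} {φ'' : M'' → ComplexPoints A''.X}

/-- **Uniqueness**: the homomorphism inducing a given map on an analytification is unique — if
`u, v : A ⟶ A'` both induce `f` (`φ' (f x) = u(ℂ)(φ x) = v(ℂ)(φ x)`, `φ` surjective), then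
`u = v` (Mumford AV §4). [cite: MumfordAV1970, §4] -/
theorem hom_unique_of_isAnalytification (hφ : IsAnalytification E A.X A.dim φ) {f : M → M'}
    {u v : A ⟶ A'} (hu : ∀ x : M, φ' (f x) = AlgPoints.map u.hom.hom.hom (φ x))
    (hv : ∀ x : M, φ' (f x) = AlgPoints.map v.hom.hom.hom (φ x)) : u = v := by
  refine hom_eq_of_forall_complexPoints fun P ↦ ?_
  obtain ⟨x, rfl⟩ := hφ.isHomeomorph.surjective P
  rw [← hu, ← hv]

/-- **Compatibility with composition**: if `u` induces `f : M → M'`, `v` induces `g : M' → M''`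
and `w` induces `g ∘ f`, then `w = u ≫ v` (Mumford AV §4; uniqueness). [cite: MumfordAV1970, §4] -/
theorem hom_comp_of_isAnalytification (hφ : IsAnalytification E A.X A.dim φ)
    {f : M → M'} {g : M' → M''} {u : A ⟶ A'} {v : A' ⟶ A''} {w : A ⟶ A''}
    (hu : ∀ x : M, φ' (f x) = AlgPoints.map u.hom.hom.hom (φ x))
    (hv : ∀ y : M', φ'' (g y) = AlgPoints.map v.hom.hom.hom (φ' y))
    (hw : ∀ x : M, φ'' (g (f x)) = AlgPoints.map w.hom.hom.hom (φ x)) : w = u ≫ v := by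
  refine hom_unique_of_isAnalytification (f := g ∘ f) hφ hw fun x ↦ ?_
  rw [map_hom_comp, ← hu, ← hv]
  rfl

/-- **Compatibility with identities**: a homomorphism inducing the identity of an
analytification is the identity (Mumford AV §4). [cite: MumfordAV1970, §4] -/
theorem hom_id_of_isAnalytification (hφ : IsAnalytification E A.X A.dim φ) {u : A ⟶ A}
    (hu : ∀ x : M, φ x = AlgPoints.map u.hom.hom.hom (φ x)) : u = 𝟙 A :=
  hom_unique_of_isAnalytification (f := id) hφ hu fun x ↦ (map_hom_id (φ x)).symm

/-- **Compatibility with addition**: if the analytification `φ'` is a group homomorphism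
(`φ' (a + b) = φ' a · φ' b`, e.g. a complex torus uniformising `A'`), `u` induces `f`, `v`
induces `g` and `w` induces the pointwise sum `x ↦ f x + g x`, then `w = u + v` in `Hom(A, A')`
(Mumford AV §19, first paragraph: addition of homomorphisms is pointwise).
[cite: MumfordAV1970, §19 (first paragraph)] -/
theorem hom_add_of_isAnalytification [Add M'] (hφ : IsAnalytification E A.X A.dim φ)
    (hφ'add : ∀ a b : M', φ' (a + b) = φ' a * φ' b)
    {f g : M → M'} {u v w : A ⟶ A'}
    (hu : ∀ x : M, φ' (f x) = AlgPoints.map u.hom.hom.hom (φ x))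
    (hv : ∀ x : M, φ' (g x) = AlgPoints.map v.hom.hom.hom (φ x))
    (hw : ∀ x : M, φ' (f x + g x) = AlgPoints.map w.hom.hom.hom (φ x)) : w = u + v := by
  refine hom_unique_of_isAnalytification (f := fun x ↦ f x + g x) hφ hw fun x ↦ ?_
  rw [map_hom_add, ← hu, ← hv, hφ'add]

end Unique

/-! ### Torus forms -/

section Torus

variable {ι : Type} [Fintype ι] {E : Type} [NormedAddCommGroup E] [NormedSpace ℂ E]
  [FiniteDimensional ℂ E] {Φ : (ι → ℝ) ≃L[ℝ] E}
  {ι' : Type} [Fintype ι'] {E' : Type} [NormedAddCommGroup E'] [NormedSpace ℂ E']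
  [FiniteDimensional ℂ E'] {Φ' : (ι' → ℝ) ≃L[ℝ] E'}
  {A A' : AbelianVariety ℂ}
  {φ : ComplexTorus Φ → ComplexPoints A.X} {φ' : ComplexTorus Φ' → ComplexPoints A'.X}

/-- **Holomorphic maps of complex tori uniformising abelian varieties are homomorphisms of
abelian varieties** (Mumford AV §1 (3); Lange–Birkenhake Prop. 1.2.1 with Cor. 2.1.17; Shimura
1998 §6.2 for the CM endomorphisms): for complex tori `T = V/Λ`, `T' = V'/Λ'`
(`ComplexTorus Φ`, `ComplexTorus Φ'`) analytifying `A`, `A'` with `φ 0 = 1`, `φ' 0 = 1`, every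
holomorphic `f : T → T'` with `f 0 = 0` is induced by a unique `u : A ⟶ A'`:
`φ' (f x) = u(ℂ)(φ x)`. [cite: MumfordAV1970, §1 (3)]
[cite: LangeBirkenhake1992, Ch. 1 Prop. 1.2.1 and Ch. 2 Cor. 2.1.17] -/
theorem exists_hom_of_mdifferentiable_complexTorus
    (hφ : IsAnalytification E A.X A.dim φ) (hφ' : IsAnalytification E' A'.X A'.dim φ')
    (hφ0 : φ 0 = 1) (hφ'0 : φ' 0 = 1)
    {f : ComplexTorus Φ → ComplexTorus Φ'} (hf : MDifferentiable 𝓘(ℂ, E) 𝓘(ℂ, E') f)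
    (hf0 : f 0 = 0) :
    ∃ u : A ⟶ A', ∀ x, φ' (f x) = AlgPoints.map u.hom.hom.hom (φ x) :=
  exists_hom_of_mdifferentiable_of_isAnalytification hφ hφ' hf hφ0 (by rw [hf0]; exact hφ'0)

/-- **`End(T) → End(A)` on sums**: for tori uniformising `A`, `A'` as groups
(`φ' (a + b) = φ' a · φ' b`) and holomorphic `f, g : T → T'` vanishing at `0`, the homomorphism
induced by `f + g` is the sum of those induced by `f` and `g` (Shimura 1998 §6.2: the
representation of `End(A)` on `V`; Mumford AV §19). [cite: MumfordAV1970, §19 (first paragraph)] -/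
theorem exists_hom_add_of_mdifferentiable_complexTorus
    (hφ : IsAnalytification E A.X A.dim φ) (hφ' : IsAnalytification E' A'.X A'.dim φ')
    (hφ0 : φ 0 = 1) (hφ'add : ∀ a b : ComplexTorus Φ', φ' (a + b) = φ' a * φ' b)
    {f g : ComplexTorus Φ → ComplexTorus Φ'} (hf : MDifferentiable 𝓘(ℂ, E) 𝓘(ℂ, E') f)
    (hg : MDifferentiable 𝓘(ℂ, E) 𝓘(ℂ, E') g) (hf0 : f 0 = 0) (hg0 : g 0 = 0) :
    ∃ u v w : A ⟶ A', (∀ x, φ' (f x) = AlgPoints.map u.hom.hom.hom (φ x)) ∧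
      (∀ x, φ' (g x) = AlgPoints.map v.hom.hom.hom (φ x)) ∧
      (∀ x, φ' (f x + g x) = AlgPoints.map w.hom.hom.hom (φ x)) ∧ w = u + v := by
  have hφ'0 : φ' 0 = 1 := by
    have h := hφ'add 0 0
    rw [add_zero] at h
    exact mul_left_cancel (h.symm.trans (mul_one _).symm)
  obtain ⟨u, hu⟩ := exists_hom_of_mdifferentiable_complexTorus hφ hφ' hφ0 hφ'0 hf hf0
  obtain ⟨v, hv⟩ := exists_hom_of_mdifferentiable_complexTorus hφ hφ' hφ0 hφ'0 hg hg0
  have hfg : MDifferentiable 𝓘(ℂ, E) 𝓘(ℂ, E') (fun x ↦ f x + g x) := by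
    have hadd : MDifferentiable (𝓘(ℂ, E').prod 𝓘(ℂ, E')) 𝓘(ℂ, E')
        (fun p : ComplexTorus Φ' × ComplexTorus Φ' ↦ p.1 + p.2) :=
      (ComplexTorus.contMDiff_add (Φ := Φ') (𝕜 := ℂ) (n := 1)).mdifferentiable one_ne_zero
    exact hadd.comp (hf.prodMk hg)
  obtain ⟨w, hw⟩ := exists_hom_of_mdifferentiable_complexTorus hφ hφ' hφ0 hφ'0 hfg
    (by rw [hf0, hg0, add_zero])
  exact ⟨u, v, w, hu, hv, hw, hom_add_of_isAnalytification hφ hφ'add hu hv hw⟩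

end Torus

end AbelianVariety

end Literature.AlgebraicGeometry.Motives
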